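import Summits.ResolutionOfSingularities.ResolutionOfSingularities.Theorems.WildQuotientsSummitReductionStubPairOrbitNormalFormBlowupModelCharts7
import Literature.AlgebraicGeometry.Resolution.AlterationsNormalFormBlowupFormalProofs
import HarnessLib

/-!
# `WildQuotients.SummitReduction` (stmt-ResolutionOfSingularities-16324), line `FramePerfect`, skeleton v9:
# stub NB1 `stub_pair_orbitNormalFormBlowup_modelSingularOverCentre` — de Jong 1996, 4.27 [C1] on
# the coefficient-free model

Route `ResolutionOfSingularities/WildQuotients`, crux `SummitReduction`; this file PROVES the
registered stub NB1 of the line skeleton (v9), the hypothesis `hNB` of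
`stub_pair_orbitNormalFormBlowup_singularOverCentre_of_model`
(`…OrbitNormalFormBlowupSingularOverCentre.lean`): for a regular local ring `A` with regular
system of parameters `t : Fin m → A`, the model `M = A⟦u, v⟧/(uv - ∏_{i<s} tᵢ)`
(`DeJong1996.NodeDeformationRing`), the centre `𝔭_{a₀b₀} = (t_{a₀}, t_{b₀}) + (u, v)`
(`a₀ < b₀ < s`) and ANY blow-up `ρ₁ : B → Spec M` in `𝔭_{a₀b₀}` (universal property,
`IsBlowup`), every non-regular point `y` of `B` over `V(𝔭_{a₀b₀})` lies on the strict transform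
— the closure of `ρ₁⁻¹(V(𝔭_{ab}) ∖ V(𝔭_{a₀b₀}))` — of another singular component `V(𝔭_{ab})`,
`a < b < s`. This is de Jong 1996, 4.27, pp. 75–76 ("We blow up the scheme
`Spec k⟦u, v, t₁, …, t_{d-1}⟧/(uv - t₁ ⋯ t_s)` in the ideal `(u, v, t₁, t₂)`. We get four charts
… Chart "`u ≠ 0`" … Clearly, this is smooth … Chart "`t₁ ≠ 0`" … `u'v' - t₂' t₃ ⋯ t_s = 0` …
The irreducible component `u' = v' = t₂' = t₃ = 0` of the singular locus maps onto
`u = v = t₂ = t₃ = 0`, the component `u' = v' = t₃ = t₄ = 0` is the strict transform of the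
component `u = v = t₃ = t₄ = 0`") made COEFFICIENT-FREE as required by de Jong 1997, proof of
Prop. 5.11 (p. 619: the same normal forms and the same blow-ups over an arbitrary field, the
base of the node being an arbitrary regular local ring). The printed Jacobian argument is
replaced by the chart algebra of `…OrbitNormalFormBlowupModelCharts*.lean` (regular system of
parameters of `A⟦u, v⟧`, derivatives in the polynomial chart variables only, and the estimate
`w · t_k ∉ Q²`); the tree's version over an algebraically closed field is
`DeJong1996NodalBlowupSingularLocus_holds`.

* `mem_closure_preimage_of_prime_le` — a prime `𝔯 ≤ z` of a chart ring off the exceptional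
  divisor and containing `K` puts the point `φ z` on the strict transform of `V(K)`;
* `stub_pair_orbitNormalFormBlowup_modelSingularOverCentre` — **the stub**: `y` lies in one of the
  four charts `Spec M[𝔭/g_j]`, `g = (ū, v̄, t̄_{a₀}, t̄_{b₀})` (`IsBlowup.exists_chart_of_span_range_eq`,
  Stacks 0804), where its local ring is a localisation of the chart ring
  (`not_isRegularLocalRing_localization_of_stalk`); the charts `u, v` are regular over the centre
  (`model_isRegularLocalRing_chartUV`), and on the charts `t_{a₀}, t_{b₀}` the point lies over a
  prime of the strict transform of some `V(𝔭_{ab})` (`model_exists_prime_le_chartT`, with the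
  symmetry `𝔭_{a₀b₀} = 𝔭_{b₀a₀}` for the last chart).

## Sources

* A. J. de Jong, *Smoothness, semi-stability and alterations*, Publ. Math. IHÉS 83 (1996), 4.27,
  pp. 75–76. [DeJong1996]
* A. J. de Jong, *Families of curves and alterations*, Ann. Inst. Fourier 47 (1997), proof of
  Prop. 5.11, p. 619. [DeJong1997]
* The Stacks Project, Tag 0804 (charts of a blowing up). [StacksProject]
-/

set_option linter.dupNamespace false -- the tree's summit namespace repeats `ResolutionOfSingularities`

noncomputable section

open CategoryTheory CategoryTheory.Limits AlgebraicGeometry TopologicalSpace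
open IsLocalRing
open Literature.AlgebraicGeometry.Resolution
open Literature.AlgebraicGeometry

namespace Summit.ResolutionOfSingularities.ResolutionOfSingularities.Theorems

/-- **A prime `𝔯` of a chart ring, below the given point and off the exceptional divisor, puts the
point on a strict transform**: for a chart `φ : Spec M[I/c] → B` of `ρ : B → Spec M`
(`φ ≫ ρ = Spec (M → M[I/c])`), a point `z` of the chart, and a prime `𝔯 ≤ z` of `M[I/c]` with
`c ∉ 𝔯 ⊇ K M[I/c]`, the point `φ z` lies in the closure of `ρ⁻¹{w | K ≤ w, P ≰ w}` for every
`P ∋ c` — the point `φ 𝔯` lies in that set and specialises to `φ z`.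
[cite: DeJong1996, 4.27, p. 76] -/
theorem mem_closure_preimage_of_prime_le {M : CommRingCat.{0}} {B : Scheme.{0}} (ρ : B ⟶ Spec M)
    {I : Ideal M} {c : M} (φ : Spec (.of (blowupAlgebra I c)) ⟶ B)
    (hφ : φ ≫ ρ = Spec.map (CommRingCat.ofHom (algebraMap M (blowupAlgebra I c))))
    (z : Spec (.of (blowupAlgebra I c))) (K P : Ideal M) (hcP : c ∈ P)
    (𝔯 : Ideal (blowupAlgebra I c)) (h𝔯 : 𝔯.IsPrime) (h𝔯z : 𝔯 ≤ z.asIdeal)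
    (hc𝔯 : algebraMap M (blowupAlgebra I c) c ∉ 𝔯) (hK𝔯 : K.map (algebraMap M (blowupAlgebra I c)) ≤ 𝔯) :
    φ.base z ∈ closure (ρ.base ⁻¹' {w | K ≤ w.asIdeal ∧ ¬ P ≤ w.asIdeal}) := by
  -- adapted from `DeJong1996.mem_closure_of_prime_le` (AlterationsNormalFormBlowupFormalProofs.lean)
  let w𝔯 : Spec (.of (blowupAlgebra I c)) := ⟨𝔯, h𝔯⟩
  have hρφ : ∀ w : Spec (.of (blowupAlgebra I c)),
      (ρ.base (φ.base w)).asIdeal = w.asIdeal.comap (algebraMap M (blowupAlgebra I c)) := by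
    intro w
    rw [← Scheme.Hom.comp_apply, hφ, Spec.map_apply]
    rfl
  have hmem : φ.base w𝔯 ∈ ρ.base ⁻¹' {w | K ≤ w.asIdeal ∧ ¬ P ≤ w.asIdeal} := by
    refine ⟨?_, ?_⟩
    · rw [hρφ, ← Ideal.map_le_iff_le_comap]
      exact hK𝔯
    · rw [hρφ]
      intro hle
      exact hc𝔯 (hle hcP)
  have hz : z ∈ closure {w𝔯} := (PrimeSpectrum.le_iff_mem_closure w𝔯 z).mp h𝔯z
  exact map_mem_closure φ.continuous hz (fun w hw => by
    rw [Set.mem_singleton_iff.mp hw]; exact hmem)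

/-- **Stub NB1 — de Jong 1996, 4.27 [C1] on the coefficient-free model.** For a regular local
ring `A` with regular system of parameters `t : Fin m → A` (`(t) = 𝔪_A`, `dim A = m`), `s`,
`a₀ < b₀ < s`, the model `M = A⟦u, v⟧/(uv - ∏_{i<s} tᵢ)` and ANY blow-up `ρ₁ : B → Spec M` in
`𝔭_{a₀b₀} = (t_{a₀}, t_{b₀}) + (u, v)`: every non-regular point `y` of `B` over `V(𝔭_{a₀b₀})`
lies in the closure of `ρ₁⁻¹(V(𝔭_{ab}) ∖ V(𝔭_{a₀b₀}))` for some `a < b < s` ("The irreducible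
component `u' = v' = t₂' = t₃ = 0` of the singular locus maps onto `u = v = t₂ = t₃ = 0`, the
component `u' = v' = t₃ = t₄ = 0` is the strict transform of the component
`u = v = t₃ = t₄ = 0`"). Proof: `y` lies in a chart `Spec M[𝔭/g_j]`, `g = (ū, v̄, t̄_{a₀}, t̄_{b₀})`,
with `g_j` in its prime; the charts `u ≠ 0`, `v ≠ 0` are regular there, and on the charts
`t_{a₀} ≠ 0`, `t_{b₀} ≠ 0` a prime `𝔯 ∌ t̄` of the strict transform of some `V(𝔭_{ab})` lies
below the point. [cite: DeJong1996, 4.27, pp. 75–76] [cite: DeJong1997, proof of Prop. 5.11, p. 619] -/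
theorem stub_pair_orbitNormalFormBlowup_modelSingularOverCentre :
    ∀ (A : Type) [CommRing A] [IsRegularLocalRing A] (m : ℕ) (t : Fin m → A),
      Ideal.span (Set.range t) = IsLocalRing.maximalIdeal A → ringKrullDim A = m →
      ∀ (s : ℕ) (a₀ b₀ : Fin m), a₀ < b₀ → b₀.val < s →
      ∀ (B : Scheme.{0}) (ρ₁ : B ⟶ Spec (.of (DeJong1996.NodeDeformationRing A
          (∏ i ∈ Finset.univ.filter (fun i : Fin m => i.val < s), t i)))),
        IsBlowup ρ₁ (Scheme.IdealSheafData.ofIdealTop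
          ((((Ideal.span {t a₀, t b₀}).map (DeJong1996.NodeDeformationRing.ofBase A _) ⊔
              Ideal.span {Ideal.Quotient.mk _ (MvPowerSeries.X 0), Ideal.Quotient.mk _ (MvPowerSeries.X 1)})).map (Scheme.ΓSpecIso (.of (DeJong1996.NodeDeformationRing A
            (∏ i ∈ Finset.univ.filter (fun i : Fin m => i.val < s), t i)))).inv.hom)) →
        ∀ y : B, ((Ideal.span {t a₀, t b₀}).map (DeJong1996.NodeDeformationRing.ofBase A _) ⊔
              Ideal.span {Ideal.Quotient.mk _ (MvPowerSeries.X 0), Ideal.Quotient.mk _ (MvPowerSeries.X 1)}) ≤ (ρ₁.base y).asIdeal → ¬ IsRegularLocalRing (B.presheaf.stalk y) →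
          ∃ a b : Fin m, a < b ∧ b.val < s ∧
            y ∈ closure (ρ₁.base ⁻¹' {w | ((Ideal.span {t a, t b}).map (DeJong1996.NodeDeformationRing.ofBase A _) ⊔
              Ideal.span {Ideal.Quotient.mk _ (MvPowerSeries.X 0), Ideal.Quotient.mk _ (MvPowerSeries.X 1)}) ≤ w.asIdeal ∧ ¬ ((Ideal.span {t a₀, t b₀}).map (DeJong1996.NodeDeformationRing.ofBase A _) ⊔
              Ideal.span {Ideal.Quotient.mk _ (MvPowerSeries.X 0), Ideal.Quotient.mk _ (MvPowerSeries.X 1)}) ≤ w.asIdeal}) := by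
  intro A _ _ m t ht hdim s a₀ b₀ hab hb₀s B ρ₁ hρ y hy hsing
  classical
  have ha₀s : a₀.val < s := lt_trans hab hb₀s
  have hne : a₀ ≠ b₀ := hab.ne
  -- the four generators `ū, v̄, t̄_{a₀}, t̄_{b₀}` of the centre
  have hJ := map_mk_span_model_eq t (∏ i ∈ Finset.univ.filter (fun i : Fin m => i.val < s), t i) a₀ b₀
  have hJ' : (Ideal.span {(MvPowerSeries.X 0 : MvPowerSeries (Fin 2) A), MvPowerSeries.X 1, MvPowerSeries.C (t b₀),
      MvPowerSeries.C (t a₀)}).map (Ideal.Quotient.mk _) = _ := (span_model_pair_comm t a₀ b₀) ▸ hJ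
  have hg : Ideal.span (Set.range (![Ideal.Quotient.mk _ (MvPowerSeries.X 0), Ideal.Quotient.mk _ (MvPowerSeries.X 1),
      Ideal.Quotient.mk _ (MvPowerSeries.C (t a₀)), Ideal.Quotient.mk _ (MvPowerSeries.C (t b₀))] : Fin 4 →
        DeJong1996.NodeDeformationRing A (∏ i ∈ Finset.univ.filter (fun i : Fin m => i.val < s), t i))) =
      (Ideal.span {t a₀, t b₀}).map (DeJong1996.NodeDeformationRing.ofBase A _) ⊔
        Ideal.span {Ideal.Quotient.mk _ (MvPowerSeries.X 0), Ideal.Quotient.mk _ (MvPowerSeries.X 1)} := by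
    rw [← hJ, Ideal.map_span, Set.range_vec4']
    simp only [Set.image_insert_eq, Set.image_singleton]
  obtain ⟨j, φ, _, ⟨z', rfl⟩, hφ⟩ := hρ.exists_chart_of_span_range_eq _ hg y
  have hz' := not_isRegularLocalRing_localization_of_stalk φ z' hsing
  -- the chart element lies in the prime of `z'`
  have hρφ : (ρ₁.base (φ.base z')).asIdeal = z'.asIdeal.comap (algebraMap _ _) := by
    rw [← Scheme.Hom.comp_apply, hφ, Spec.map_apply]
    rfl
  have hgj : algebraMap _ _ ((![Ideal.Quotient.mk _ (MvPowerSeries.X 0), Ideal.Quotient.mk _ (MvPowerSeries.X 1),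
      Ideal.Quotient.mk _ (MvPowerSeries.C (t a₀)), Ideal.Quotient.mk _ (MvPowerSeries.C (t b₀))] : Fin 4 →
        DeJong1996.NodeDeformationRing A (∏ i ∈ Finset.univ.filter (fun i : Fin m => i.val < s), t i)) j) ∈
      z'.asIdeal := by
    rw [← Ideal.mem_comap, ← hρφ]
    exact hy (hg ▸ Ideal.subset_span ⟨j, rfl⟩)
  fin_cases j
  · -- chart `u ≠ 0`: regular
    exact absurd (model_isRegularLocalRing_chartUV t ht hdim s 0 1 (by decide) a₀ b₀ hne ha₀s hb₀s hJ
      z'.asIdeal z'.isPrime hgj) hz'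
  · -- chart `v ≠ 0`: regular
    exact absurd (model_isRegularLocalRing_chartUV t ht hdim s 1 0 (by decide) a₀ b₀ hne ha₀s hb₀s hJ
      z'.asIdeal z'.isPrime hgj) hz'
  · -- chart `t_{a₀} ≠ 0`
    obtain ⟨a, b, hab', hbs, 𝔯, h𝔯p, h𝔯le, h𝔯a, h𝔯K⟩ :=
      model_exists_prime_le_chartT t ht hdim s a₀ b₀ hne ha₀s hb₀s hJ z'.asIdeal z'.isPrime hgj hz'
    refine ⟨a, b, hab', hbs, mem_closure_preimage_of_prime_le ρ₁ φ hφ z' _ _ ?_ 𝔯 h𝔯p h𝔯le h𝔯a h𝔯K⟩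
    exact hg ▸ Ideal.subset_span ⟨2, rfl⟩
  · -- chart `t_{b₀} ≠ 0` (by the symmetry `𝔭_{a₀b₀} = 𝔭_{b₀a₀}`)
    obtain ⟨a, b, hab', hbs, 𝔯, h𝔯p, h𝔯le, h𝔯a, h𝔯K⟩ :=
      model_exists_prime_le_chartT t ht hdim s b₀ a₀ hne.symm hb₀s ha₀s hJ' z'.asIdeal z'.isPrime hgj hz'
    refine ⟨a, b, hab', hbs, mem_closure_preimage_of_prime_le ρ₁ φ hφ z' _ _ ?_ 𝔯 h𝔯p h𝔯le h𝔯a h𝔯K⟩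
    exact hg ▸ Ideal.subset_span ⟨3, rfl⟩

end Summit.ResolutionOfSingularities.ResolutionOfSingularities.Theorems

end
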